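import Summits.CriticalPhenomena.PercolationContinuityZ3.Theorems.FK.Transplant.KNFreeStepsSetting
import HarnessLib

/-!
# FK-continuity transplant, FT-06 (part 2): Step III and the chain (36)–(37) for one direction under the minimal
# law `P^x` — `P^x(bad) ≤ (1 - δ₂)^K + ε'` for every pinning law (the content of binder h_bad `KNFreeBadBound`)

Cell `fk-continuity` (bschramm), FRONTIER TRANSPLANT sub-cell, registry row FT-06 (`KNFreeSteps`), BINDER-OWNERS
row 7 (h_bad); support file (`--supports stmt-CriticalPhenomena-4575`); builds on p205010 (kernel theorem, internal
audit signed; external expert review pending). HONEST FRAMING: the transplant `ufsc0_of_freeBoundaryHypothesis_r0`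
this file serves is CONDITIONAL on the free-boundary penetration hypothesis FH (open at the same `p` for `q > 1`;
⇔ GRC Conj. (5.103) via the referee's calibration K1: "[C3a ∀ p > p_c(q)] ∧ C3b ⇒ p̂_c(q) = p_c(q) = GRC Conj (5.103)
= DT Question 5 (open for q ∈ (1,2))"; barrier note `Literature.Barriers.CriticalPhenomena.SamePFreeBoundaryCriteria`,
p243859); it is a typed reduction, not a proof of FK continuity. THIS file is unconditional: no named facts, no
sorries, standard axioms; `FH` does not occur in it.

## What is here (continuing `KNFreeStepsSetting.lean`)

Kozma–Nitzan, arXiv:2401.12397 §4, Theorem 6 Steps III–IV (pp. 30–31) for ONE onward direction `x = v + du` after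
an FK-valid history, under the per-direction MINIMAL law `P^x = fkLaw (S.Sx h e du) (S.Wfull h e du) q`
(REFUTER-REPORT §8 F4), for the law functor `W ↦ fkLaw (S.Sx h e du) W q` ASSUMED to be a pinning law on
`D ⊇ pairsF (Sx h e du)` (`Transplant.IsPinningLaw`, FT-06b; instance: FT-06d `isPinningLaw_fkLaw`):

* `condFK_of_face` — **Step III** (p. 30): the FK target inequality `FKTargetAt d q p δ₂ δ (elongList d (2K)) R`
  (FT-01; binder h_tgt's matrix) with `2R ≤ s` turns "`F^{j+1}_{v,x}` reached from `0` with probability `> 1 - δ₂`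
  under the level-`j` law" into "the connection is good at level `j`" — KN's geometry verbatim (`Dpast`,
  `isTarget_stepIII`, the subbox `IsSubbox (Wt …) p Dpast`); hence `badFK ⊆ B_j` (`badFK_subset_BevFK`).
* `real_Aface_pin_le` — one step of (36): for a pattern `T` of level `j` in `B_j` (in the record's cylinder,
  lattice-only) the PINNED law of `Wfull` is the law of the level-`j` weighting `Wt` (tree `pinW_Wfull_eq_Wt`, an
  identity of weightings), so it reaches `F^{j+1}` inside `… ∪ H^{j+1}` with probability `≤ 1 - δ₂`.
* `real_badFK_le_of_isPinningLaw` — **(36)–(37)**: `P^x(badFK) ≤ (1 - δ₂)^K + ε'` from the FK corridor inequality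
  `FKCorridorAt d q p δ ε' r` (binder h_corr's matrix; Step IV first claim `reach_boundFK`, part 1) and the target
  inequality, by FT-06b's law-generic chain `IsPinningLaw.real_bad_le`: every conditioning is the exact pinning
  identity (P) under `P^x` (Grimmett Thm. (3.7)) — no independence. This is binder `KNFreeBadBound` up to the
  instance `isPinningLaw_fkLaw` and the support change of (32) (file `KNFreeBad.lean`).

## References

* G. Kozma, S. Nitzan, arXiv:2401.12397 (2024), §4 pp. 27–31 ((30), (32), (33), (36), (37)). [KozmaNitzan2024]
* G. Grimmett, *The Random-Cluster Model*, Springer 2006: Thm. (3.7) p. 39; Thm. (3.21), eq. (3.22). [Grimmett2006]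
* Cell documents: REFUTER-REPORT §8 F4 (prim-bschramm-fkp-18r); transplant/BINDER-OWNERS.md row 7.
-/

noncomputable section

open MeasureTheory Finset
open scoped ENNReal Classical

namespace Summit.CriticalPhenomena.PercolationContinuityZ3.Theorems.FK

open Literature.Probability.Percolation Literature.Probability.LatticeModels
open Literature.Probability.Percolation.KozmaNitzan Literature.Probability.Percolation.GadgetSystem
open Transplant KSch Cells

variable {d : ℕ} {S : KSch d} {q : ℝ}

section Examination

variable {D : Set (Sym2 (Site d))}
variable {h : ProbeHistory (Site d)} {e : Site 2 × MDir} (hV : ValidFK S q h e) {du : MDir}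
  (hdu : du ∈ S.onward h (tgt e))
include hV hdu

/-! ## Step III under the law: the target lemma turns "`F^{j+1}` reached" into "good at level `j`" -/

/-- **Step III under a law** (KN p. 30): if `F^{j+1}_{v,x}` is reached from `0` with probability `> 1 - δ₂` under the
law of the weighting of level `j`, then the connection is good at level `j` — by the target lemma under the law,
here the hypothesis `htgt` (FT-03's `KNFreeTargetProperty` shape: KN's `htgt` of `KSch.cond_of_face` with the law
swapped). The geometry (`IsSubbox`, `Dpast`, `isTarget_stepIII`) is KN's, verbatim. [cite: KozmaNitzan2024, §4 p. 30 (Step III)] -/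
theorem condFK_of_face {δ₂ : ℝ} {R : ℕ}
    (htgt : FKTargetAt d q S.p δ₂ S.δc (elongList d (2 * S.C.K) (by have := S.C.hK; omega)) R)
    (hRs : 2 * R ≤ S.C.s) {j : ℕ} (hj : j < S.C.K) (o : Finset (Sym2 (Site d)))
    (hface : 1 - δ₂ < (fkLaw (S.Sx h e du) (S.Wt h e du j o) q).real
      (⋃ b ∈ S.C.Face (tgt e) du (j + 1), openConn (0 : Site d) b)) :
    condFK S q h e du j o := by
  have hdu' : du ∈ (geomTwin S).onward h (tgt e) := hdu
  have hV' : (geomTwin S).Valid h e := geomTwin_valid_of_validFK hV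
  set D' := Dpast S e du j with hD'
  have hK : (20 : ℤ) ≤ S.C.K := by exact_mod_cast S.C.hK
  have hs1 : (1 : ℤ) ≤ S.C.s := by exact_mod_cast S.C.hs
  have hr1 : (1 : ℤ) ≤ S.C.r := by exact_mod_cast S.C.r_pos
  have hrK : (S.C.r : ℤ) = S.C.K * S.C.s := by unfold Cells.r; push_cast; ring
  have hRs' : 2 * (R : ℤ) ≤ S.C.s := by exact_mod_cast hRs
  have hjK : (j : ℤ) + 1 ≤ S.C.K := by exact_mod_cast hj
  have hjs : 10 * (S.C.s : ℤ) * (j + 1) ≤ 10 * S.C.s * S.C.K := mul_le_mul_of_nonneg_left hjK (by positivity)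
  have hKs20 : 20 * (S.C.s : ℤ) ≤ S.C.K * S.C.s := mul_le_mul_of_nonneg_right hK (by linarith)
  have hj0 : (0 : ℤ) ≤ 10 * S.C.s * j := by positivity
  have hDE : D' ⊆ S.C.Efar (tgt e) du := Dpast_subset_Efar j
  have hDS : D' ⊆ S.Sx h e du := hDE.trans Finset.subset_union_right
  -- the subbox
  have hsub : IsSubbox (S.Wt h e du j o) S.p D' := by
    refine ((isSubbox_lattW S.p D').pinW _ fun x hx y hy hyD => ?_).restrW (Finset.coe_subset.2 hDS)
    have hx' : x ∈ S.Fj h e du j := hx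
    rw [KSch.Fj, mem_edgesIn_iff] at hx'
    rcases Finset.mem_union.1 (hx'.2 y hy) with hy' | hy'
    · rcases Finset.mem_union.1 hy' with hy'' | hy''
      · exact (KSch.Valid.sep_Efar (S := (geomTwin S)) hV' hdu').not_mem (Finset.mem_coe.2 hy'') (Finset.mem_coe.2 (hDE hyD))
      · exact KSch.Valid.Ewv_not_mem_Efar (S := (geomTwin S)) hV' hdu' hy'' (hDE hyD)
    · rw [Cells.Stub, mem_sBox_iff (sgOf_sign du)] at hy'
      rw [hD', Dpast, mem_sBox_iff (sgOf_sign du)] at hyD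
      linarith [hy'.1.2, hyD.1.1]
  have h0S : (0 : Site d) ∈ S.Sx h e du := Finset.mem_union_left _ (Finset.mem_union_left _ hV.zero_mem)
  have h0D : (0 : Site d) ∉ D' := fun h0 =>
    (KSch.Valid.sep_Efar (S := (geomTwin S)) hV' hdu').not_mem (Finset.mem_coe.2 hV.zero_mem) (Finset.mem_coe.2 (hDE h0))
  -- the enlarged face lies in `D'`
  have hencl : Finset.Icc (sLo (S.C.axOf du) (sgOf du) (S.C.cen (tgt e)) (5 * S.C.r + 10 * S.C.s * (j + 1 : ℕ))
        (5 * S.C.r + 10 * S.C.s * (j + 1 : ℕ)) (2 * S.C.r) - (R : Site d))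
      (sHi (S.C.axOf du) (sgOf du) (S.C.cen (tgt e)) (5 * S.C.r + 10 * S.C.s * (j + 1 : ℕ))
        (5 * S.C.r + 10 * S.C.s * (j + 1 : ℕ)) (2 * S.C.r) + (R : Site d)) ⊆ D' := by
    rw [sBox_enlarge _ _ (sgOf_sign du)]
    refine sBox_mono (sgOf_sign du) _ ?_ ?_ ?_
    · push_cast; linarith
    · push_cast; nlinarith
    · linarith
  -- `M_x ⊆ D'`
  have hMD : S.C.M (tgt e + stepVec du) ⊆ D' := by
    intro y hy
    obtain ⟨hl, ht⟩ := S.C.level_of_mem_M_tgt hy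
    rw [hD', Dpast, mem_sBox_iff (sgOf_sign du)]
    refine ⟨⟨by nlinarith [hl.1], by linarith [hl.2]⟩, fun i hi => ?_⟩
    have := ht i hi; constructor <;> linarith [this.1, this.2]
  have hMne : (S.C.M (tgt e + stepVec du)).Nonempty := ⟨_, center_mem_cIcc _ _⟩
  exact htgt (S.Wt h e du j o) (S.Sx h e du) D' _ _ (S.C.M (tgt e + stepVec du)) 0 (finSupp_restrW _ _) hsub hDS h0S
    h0D hencl (isTarget_stepIII hRs hj) hMD hMne hface

/-- **Step III inside Step IV**: a bad direction lies in every `B_j`. [cite: KozmaNitzan2024, §4 p. 30 (Step III)] -/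
theorem badFK_subset_BevFK {δ₂ : ℝ} {R : ℕ}
    (htgt : FKTargetAt d q S.p δ₂ S.δc (elongList d (2 * S.C.K) (by have := S.C.hK; omega)) R)
    (hRs : 2 * R ≤ S.C.s) {j : ℕ} (hj : j < S.C.K) : badFK S q h e du ⊆ BevFK S q h e du j δ₂ := by
  intro ω hω
  by_contra hB
  simp only [BevFK, Set.mem_setOf_eq, not_le] at hB
  exact hω j hj (condFK_of_face hV hdu htgt hRs hj _ hB)

/-! ## The chain (36)–(37) under the law: a bad direction is unlikely under `μ_{Wfull}` -/

/-- **One step of the chain under a pinning law**: for a pattern `T` of the pairs of level `j` lying in `B_j`, in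
the cylinder of the record and lattice-only, the pinned law of `Wfull` IS the law of the weighting of (30) at level
`j` (`KSch.pinW_Wfull_eq_Wt`, an identity of weightings), so it reaches `F^{j+1}` inside `… ∪ H^{j+1}` with
probability `≤ 1 - δ₂`. [cite: KozmaNitzan2024, §4 p. 31 ((36)); p. 30 (Step III: the auxiliary graph)] -/
theorem real_Aface_pin_le (hL : IsPinningLaw (fun W => fkLaw (S.Sx h e du) W q) D) {δ₂ : ℝ} {j : ℕ} (hj : j < S.C.K) {T : Finset (Sym2 (Site d))}
    (hTB : (↑T : Set (Sym2 (Site d))) ∈ BevFK S q h e du j δ₂)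
    (hTc : (↑T : Set (Sym2 (Site d))) ∈ localCylinder (↑(S.F h) : Set (Sym2 (Site d))) ↑(S.ξ h))
    (hTl : (↑T : Set (Sym2 (Site d))) ∈ lattOnly (S.V h ∪ S.C.Ewv e.1 e.2 ∪ S.C.Stub (tgt e) du j)) :
    (fkLaw (S.Sx h e du) (pinW (S.Wfull h e du) ↑(S.Fp h e du j) ↑T) q).real (S.Aface h e du j) ≤ 1 - δ₂ := by
  have hdu' : du ∈ (geomTwin S).onward h (tgt e) := hdu
  have hV' : (geomTwin S).Valid h e := geomTwin_valid_of_validFK hV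
  haveI := hL.prob (S.Wt h e du j (obs ↑T (S.env h e)))
  have key : pinW (S.Wfull h e du) ↑(S.Fp h e du j) ↑T = S.Wt h e du j (obs ↑T (S.env h e)) :=
    KSch.pinW_Wfull_eq_Wt (S := (geomTwin S)) hV' hdu' hj hTc hTl
  rw [key]
  have hTB' : (fkLaw (S.Sx h e du) (S.Wt h e du j (obs ↑T (S.env h e))) q).real
      (⋃ b ∈ S.C.Face (tgt e) du (j + 1), openConn (0 : Site d) b) ≤ 1 - δ₂ := hTB
  refine le_trans (measureReal_mono ?_ (measure_ne_top _ _)) hTB'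
  rw [KSch.Aface, ← Finset.set_biUnion_coe]
  exact biUnion_openConnIn_subset_biUnion_openConn _ _ _

/-- **(36)–(37) for one direction under a pinning law, core form** — given directly the Step-IV first claim
`P^x(0 ↔ M_x in E_i ∪ E_{w,v} ∪ H_{v,x}) > 1 - ε'` (`hreach`), the FK target inequality (`htgt`, FT-01
`FKTargetAt`; binder h_tgt's matrix) with `2R ≤ s`, an FK-valid history and a pinning law on `D ⊇ pairsF Sx`:
`P^x(badFK) ≤ (1 - δ₂)^K + ε'`. Every conditioning is the exact pinning identity (P) of the law: no independence
is used. The two corridor forms (`FKCorridorAt`, v1; the RESTRICTED `FKCorridorRestrAt` of the record, v2) feed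
`hreach` through `reach_boundFK` resp. `reach_boundFK_restr`. [cite: KozmaNitzan2024, §4 p. 31 ((36), (37))] -/
theorem real_badFK_le_of_reach (hL : IsPinningLaw (fun W => fkLaw (S.Sx h e du) W q) D)
    (hD : (↑(pairsF (S.Sx h e du)) : Set (Sym2 (Site d))) ⊆ D) {ε' δ₂ : ℝ} (hδ₂ : δ₂ ≤ 1) {R : ℕ}
    (hreach : 1 - ε' < (fkLaw (S.Sx h e du) (S.Wfull h e du) q).real (S.Reach h e du))
    (htgt : FKTargetAt d q S.p δ₂ S.δc (elongList d (2 * S.C.K) (by have := S.C.hK; omega)) R)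
    (hRs : 2 * R ≤ S.C.s) :
    (fkLaw (S.Sx h e du) (S.Wfull h e du) q).real (badFK S q h e du) ≤ (1 - δ₂) ^ S.C.K + ε' := by
  have hdu' : du ∈ (geomTwin S).onward h (tgt e) := hdu
  have hV' : (geomTwin S).Valid h e := geomTwin_valid_of_validFK hV
  set K := S.C.K with hKdef
  have hK1 : 1 ≤ K := by have := S.C.hK; omega
  -- the a.s. set
  set N : Set (BondConfig (Site d)) :=
    localCylinder (↑(S.F h) : Set (Sym2 (Site d))) ↑(S.ξ h) ∩ lattOnly (S.Sx h e du) with hN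
  have hN0 : (fkLaw (S.Sx h e du) (S.Wfull h e du) q).real Nᶜ = 0 := real_compl_asSet_eq_zero hV hdu hL hD
  -- the data of the abstract chain, truncated at `K`
  set Fp : ℕ → Finset (Sym2 (Site d)) := fun j => S.Fp h e du (min j K) with hFp
  set A : ℕ → Set (BondConfig (Site d)) := fun j => if j < K then S.Aface h e du j else Set.univ with hA
  set E : ℕ → Set (BondConfig (Site d)) := fun j =>
    if j < K then BevFK S q h e du j δ₂ ∩ (localCylinder (↑(S.F h) : Set (Sym2 (Site d))) ↑(S.ξ h) ∩
      lattOnly (S.V h ∪ S.C.Ewv e.1 e.2 ∪ S.C.Stub (tgt e) du j)) else Set.univ with hE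
  have hFpD : ∀ j, (↑(Fp j) : Set (Sym2 (Site d))) ⊆ D := fun j =>
    (KSch.coe_Fp_subset_wireSet S h e du (Nat.min_le_right j K)).trans (by rw [← coe_pairsF]; exact hD)
  have hFpm : ∀ j, Fp j ⊆ Fp (j + 1) := fun j =>
    KSch.Fp_mono S h e du (by omega)
  have hAdet : ∀ j, DeterminedBy (A j) (↑(Fp (j + 1)) : Set (Sym2 (Site d))) := by
    intro j
    by_cases hj : j < K
    · simp only [hA, hFp, if_pos hj, show min (j + 1) K = j + 1 from by omega]
      exact KSch.determinedBy_Aface S h e du j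
    · simp only [hA, if_neg hj]; exact determinedBy_univ _
  have hAm : ∀ j, MeasurableSet (A j) := by
    intro j
    by_cases hj : j < K
    · simp only [hA, if_pos hj]; exact KSch.measurableSet_Aface S h e du j
    · simp only [hA, if_neg hj]; exact MeasurableSet.univ
  have hEdet : ∀ j, DeterminedBy (E j) (↑(Fp j) : Set (Sym2 (Site d))) := by
    intro j
    by_cases hj : j < K
    · simp only [hE, hFp, if_pos hj, show min j K = j from by omega]
      refine ((determinedBy_BevFK h e du j δ₂).mono (Finset.coe_subset.2 (KSch.Fj_subset_Fp S h e du j))).inter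
        (DeterminedBy.inter ?_ ?_)
      · exact (determinedBy_localCylinder _ _).mono (KSch.Valid.coe_F_subset_Fp (S := (geomTwin S)) hV' j)
      · exact (determinedBy_lattOnly _).mono (by rw [KSch.Fp])
    · simp only [hE, if_neg hj]; exact determinedBy_univ _
  have hEm : ∀ j, MeasurableSet (E j) := fun j => (hEdet j).measurableSet_of_finset
  -- the chain step
  have hstep : ∀ j < K, ∀ T ⊆ Fp j, (↑T : Set (Sym2 (Site d))) ∈ E j →
      (fkLaw (S.Sx h e du) (pinW (S.Wfull h e du) ↑(Fp j) ↑T) q).real (A j) ≤ 1 - δ₂ := by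
    intro j hj T _ hTE
    simp only [hE, hA, hFp, if_pos hj, show min j K = j from by omega] at hTE ⊢
    obtain ⟨hTB, hTc, hTl⟩ := hTE
    exact real_Aface_pin_le hV hdu hL hj hTB hTc hTl
  -- the inclusions
  have hbad : ∀ j < K, badFK S q h e du ⊆ BevFK S q h e du j δ₂ := fun j hj => badFK_subset_BevFK hV hdu htgt hRs hj
  have hEB : ∀ j < K, BevFK S q h e du j δ₂ ∩ N ⊆ E j := by
    intro j hj ω hω
    simp only [hE, if_pos hj]
    exact ⟨hω.1, hω.2.1, lattOnly_anti (KSch.region_subset_Sx S h e du hj.le) hω.2.2⟩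
  have hreachA : ∀ j < K, S.Reach h e du ∩ N ⊆ A j := by
    intro j hj ω hω
    simp only [hA, if_pos hj]
    exact KSch.mem_Aface_of_reach (S := (geomTwin S)) hV' hdu'
      (lattOnly_anti (KSch.regionH_subset_Sx S h e du) hω.2.2) hω.1 hj
  have main := hL.real_bad_le (S.Wfull h e du) hFpD hFpm hAdet hAm hEdet hEm hδ₂ hstep hN0 hN0
    (measurableSet_biUnion_openConnIn _ _ _) hbad hEB hreachA hreach
  exact main



/-! ## The restricted corridor form of the record (v2 `FKCorridorRestrAt`) -/

/-- The weighting `W₀` of (32) is the weighting `Wfull` restricted to `A = E_i ∪ E_{w,v}` (`= (cdOf S h e du).Aset`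
after a valid history). [cite: KozmaNitzan2024, §4 p. 28 ((32)), p. 31 (Lemma 12 with A = E_i ∪ E_{w,v})] -/
theorem restrW_Aset_Wfull_eq_W₀ :
    restrW (↑(cdOf S h e du).Aset : Set (Site d)) (S.Wfull h e du) = S.W₀ h e := by
  have hdu' : du ∈ (geomTwin S).onward h (tgt e) := hdu
  have hV' : (geomTwin S).Valid h e := geomTwin_valid_of_validFK hV
  have hA : (cdOf S h e du).Aset = S.V h ∪ S.C.Ewv e.1 e.2 := KSch.Valid.cd_Aset (S := (geomTwin S)) hV' hdu'
  rw [hA]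
  funext x
  unfold KSch.Wfull KSch.W₀
  by_cases hx : x ∈ wireSet (↑(S.V h ∪ S.C.Ewv e.1 e.2) : Set (Site d))
  · have hxS : x ∈ wireSet (↑(S.Sx h e du) : Set (Site d)) :=
      KozmaNitzan.wireSet_mono (Finset.coe_subset.2 (Finset.subset_union_left)) hx
    rw [restrW_apply_of_mem _ hx, restrW_apply_of_mem _ hxS, restrW_apply_of_mem _ hx]
  · rw [restrW_apply_of_not_mem _ hx, restrW_apply_of_not_mem _ hx]

/-- **Step IV, first claim, from the RESTRICTED corridor inequality** (the form of the record, FT-01b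
`FKCorridorRestrAt`, KN's "in the subgraph" Lemma 12 p. 24): if (32)-FK holds under the law of `W₀` on `Sx` and the
restricted corridor implication holds for the examination datum `cdOf S h e du` (hypothesis under the law of
`Wfull` restricted to `A = E_i ∪ E_{w,v}`, conclusion under the law of `Wfull` restricted to `U = A ∪ H_{v,x}`), then
`P^x(0 ↔ M_x in U) > 1 - ε'`: under the `U`-restricted law every open pair lies in `U` a.s. ((S),(N)), so
`{0 ↔ M_x} = {0 ↔ M_x in U}` a.s., and `restrW U Wfull ≤ Wfull` ((M)). [cite: KozmaNitzan2024, §4 pp. 30–31 (Step IV), p. 24] -/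
theorem reach_boundFK_restr (hL : IsPinningLaw (fun W => fkLaw (S.Sx h e du) W q) D) {ε' : ℝ}
    (hreach0 : 1 - S.δc < (fkLaw (S.Sx h e du) (S.W₀ h e) q).real (⋃ t ∈ S.C.M (tgt e), openConn (0 : Site d) t))
    (hcorr : 1 - S.δc < (fkLaw (S.Sx h e du) (restrW (↑(cdOf S h e du).Aset : Set (Site d)) (S.Wfull h e du)) q).real
        (⋃ b ∈ Finset.Icc ((cdOf S h e du).c - ((3 * (cdOf S h e du).r : ℕ) : Site d))
          ((cdOf S h e du).c + ((3 * (cdOf S h e du).r : ℕ) : Site d)), openConn (cdOf S h e du).o b) →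
      1 - ε' < (fkLaw (S.Sx h e du) (restrW (↑(cdOf S h e du).Uset : Set (Site d)) (S.Wfull h e du)) q).real
        (⋃ b ∈ (cdOf S h e du).Tn (3 * (cdOf S h e du).r), openConn (cdOf S h e du).o b)) :
    1 - ε' < (fkLaw (S.Sx h e du) (S.Wfull h e du) q).real (S.Reach h e du) := by
  have hdu' : du ∈ (geomTwin S).onward h (tgt e) := hdu
  have hV' : (geomTwin S).Valid h e := geomTwin_valid_of_validFK hV
  set T := cdOf S h e du with hT
  have hA : T.Aset = S.V h ∪ S.C.Ewv e.1 e.2 := KSch.Valid.cd_Aset (S := (geomTwin S)) hV' hdu'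
  set U : Finset (Site d) := S.V h ∪ S.C.Ewv e.1 e.2 ∪ S.C.Hfull (tgt e) du with hUdef
  have hU : T.Uset = U := by
    change T.Aset ∪ S.C.Hfull (tgt e) du = _
    rw [hA]
  have hTn : T.Tn (3 * T.r) = S.C.M (tgt e + stepVec du) := by
    change Finset.Icc (T.cnext - ((3 * S.C.r : ℕ) : Site d)) (T.cnext + ((3 * S.C.r : ℕ) : Site d)) = _
    rw [KSch.cd_cnext]; rfl
  have h0U : (0 : Site d) ∈ (↑U : Set (Site d)) :=
    Finset.mem_coe.2 (Finset.mem_union_left _ (Finset.mem_union_left _ hV.zero_mem))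
  -- the restricted corridor inequality applied to `(32)`
  have hyp : 1 - S.δc < (fkLaw (S.Sx h e du) (restrW (↑T.Aset : Set (Site d)) (S.Wfull h e du)) q).real
      (⋃ b ∈ Finset.Icc (T.c - ((3 * T.r : ℕ) : Site d)) (T.c + ((3 * T.r : ℕ) : Site d)), openConn T.o b) := by
    rw [restrW_Aset_Wfull_eq_W₀ hV hdu]
    exact hreach0
  have concl := hcorr hyp
  rw [hTn, hU] at concl
  set W' := restrW (↑U : Set (Site d)) (S.Wfull h e du) with hW'
  haveI := hL.prob W'
  -- under the `U`-restricted law every open pair lies in `U`, almost surely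
  set N : Set (BondConfig (Site d)) := {ω | ω ⊆ D} ∩ localCylinder (D \ wireSet (↑U : Set (Site d))) ∅ with hN
  have hN0 : (fkLaw (S.Sx h e du) W' q).real Nᶜ = 0 := by
    have h1 := hL.subset W'
    have h2 : (fkLaw (S.Sx h e du) W' q).real (localCylinder (D \ wireSet (↑U : Set (Site d))) ∅)ᶜ = 0 := by
      refine hL.null _ _ ∅ Set.sdiff_subset (Set.to_countable _) (fun x _ hx => (Set.notMem_empty x hx).elim)
        (fun x hx _ => ?_)
      exact restrW_apply_of_not_mem _ hx.2
    rw [hN, Set.compl_inter]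
    exact le_antisymm ((measureReal_union_le _ _).trans (by rw [h1, h2, add_zero])) measureReal_nonneg
  have hstep1 : (fkLaw (S.Sx h e du) W' q).real (⋃ b ∈ S.C.M (tgt e + stepVec du), openConn (0 : Site d) b) ≤
      (fkLaw (S.Sx h e du) W' q).real (S.Reach h e du) := by
    have hsub : (⋃ b ∈ S.C.M (tgt e + stepVec du), openConn (0 : Site d) b) ⊆ S.Reach h e du ∪ Nᶜ := by
      intro ω hω
      by_cases hωN : ω ∈ N
      · left
        rw [KSch.Reach]
        simp only [Set.mem_iUnion, exists_prop, Finset.mem_coe] at hω ⊢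
        obtain ⟨t, ht, hωt⟩ := hω
        refine ⟨t, ht, ?_⟩
        rw [DCT16.mem_openConnIn_iff_pathIn]
        have hω' : ∀ x ∈ ω, x ∈ wireSet (↑U : Set (Site d)) := fun x hx => by
          by_contra hxU
          exact ((hωN.2 x ⟨hωN.1 hx, hxU⟩).1 hx).elim
        exact pathIn_of_reachable_of_forall_mem_wireSet hω' h0U hωt
      · exact Or.inr hωN
    exact (measureReal_mono hsub (measure_ne_top _ _)).trans
      ((measureReal_union_le _ _).trans (by rw [hN0, add_zero]))
  -- (M): `restrW U Wfull ≤ Wfull`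
  have hstep2 : (fkLaw (S.Sx h e du) W' q).real (S.Reach h e du) ≤
      (fkLaw (S.Sx h e du) (S.Wfull h e du) q).real (S.Reach h e du) := by
    refine hL.mono _ _ (fun x _ => ?_) _ (isUpperSet_biUnion_openConnIn _ _ _) (measurableSet_biUnion_openConnIn _ _ _)
    by_cases hx : x ∈ wireSet (↑U : Set (Site d))
    · rw [hW', restrW_apply_of_mem _ hx]
    · rw [hW', restrW_apply_of_not_mem _ hx]; exact bot_le
  exact lt_of_lt_of_le concl (hstep1.trans hstep2)

/-- **(36)–(37) for one direction, v1 corridor form**: as `real_badFK_le_of_reach`, with the Step-IV first claim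
supplied by (32) under `W₀` and the corridor inequality `FKCorridorAt` (FT-01 v1) via `reach_boundFK`.
[cite: KozmaNitzan2024, §4 p. 31 ((36), (37))] -/
theorem real_badFK_le_of_isPinningLaw (hL : IsPinningLaw (fun W => fkLaw (S.Sx h e du) W q) D)
    (hD : (↑(pairsF (S.Sx h e du)) : Set (Sym2 (Site d))) ⊆ D) {ε' δ₂ : ℝ} (hδ₂ : δ₂ ≤ 1) {R : ℕ}
    (hreach0 : 1 - S.δc < (fkLaw (S.Sx h e du) (S.W₀ h e) q).real (⋃ t ∈ S.C.M (tgt e), openConn (0 : Site d) t))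
    (hcorr : FKCorridorAt d q S.p S.δc ε' S.C.r)
    (htgt : FKTargetAt d q S.p δ₂ S.δc (elongList d (2 * S.C.K) (by have := S.C.hK; omega)) R)
    (hRs : 2 * R ≤ S.C.s) :
    (fkLaw (S.Sx h e du) (S.Wfull h e du) q).real (badFK S q h e du) ≤ (1 - δ₂) ^ S.C.K + ε' :=
  real_badFK_le_of_reach hV hdu hL hD hδ₂ (reach_boundFK hV hdu hL hreach0 hcorr) htgt hRs

/-- **(36)–(37) for one direction, RESTRICTED corridor form of the record** (binder `KNFreeBadRestr` of FT-01b up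
to the instance `isPinningLaw_fkLaw` and the support change of (32)): as `real_badFK_le_of_reach`, with the
Step-IV first claim supplied by (32) under `W₀` and the restricted corridor implication for the examination datum
(an instance of `FKCorridorRestrAt d q p δ ε' r` at `T = cdOf S h e du`, `r ≤ T.r`) via `reach_boundFK_restr`.
[cite: KozmaNitzan2024, §4 p. 31 ((36), (37)), p. 24] -/
theorem real_badFK_le_of_corridorRestr (hL : IsPinningLaw (fun W => fkLaw (S.Sx h e du) W q) D)
    (hD : (↑(pairsF (S.Sx h e du)) : Set (Sym2 (Site d))) ⊆ D) {ε' δ₂ : ℝ} (hδ₂ : δ₂ ≤ 1) {R : ℕ}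
    (hreach0 : 1 - S.δc < (fkLaw (S.Sx h e du) (S.W₀ h e) q).real (⋃ t ∈ S.C.M (tgt e), openConn (0 : Site d) t))
    (hcorr : 1 - S.δc < (fkLaw (S.Sx h e du) (restrW (↑(cdOf S h e du).Aset : Set (Site d)) (S.Wfull h e du)) q).real
        (⋃ b ∈ Finset.Icc ((cdOf S h e du).c - ((3 * (cdOf S h e du).r : ℕ) : Site d))
          ((cdOf S h e du).c + ((3 * (cdOf S h e du).r : ℕ) : Site d)), openConn (cdOf S h e du).o b) →
      1 - ε' < (fkLaw (S.Sx h e du) (restrW (↑(cdOf S h e du).Uset : Set (Site d)) (S.Wfull h e du)) q).real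
        (⋃ b ∈ (cdOf S h e du).Tn (3 * (cdOf S h e du).r), openConn (cdOf S h e du).o b))
    (htgt : FKTargetAt d q S.p δ₂ S.δc (elongList d (2 * S.C.K) (by have := S.C.hK; omega)) R)
    (hRs : 2 * R ≤ S.C.s) :
    (fkLaw (S.Sx h e du) (S.Wfull h e du) q).real (badFK S q h e du) ≤ (1 - δ₂) ^ S.C.K + ε' :=
  real_badFK_le_of_reach hV hdu hL hD hδ₂ (reach_boundFK_restr hV hdu hL hreach0 hcorr) htgt hRs

end Examination

end Summit.CriticalPhenomena.PercolationContinuityZ3.Theorems.FK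

end
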